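import Literature.Probability.LatticeModels.LatticeDobrushinDomain
import Literature.Probability.LatticeModels.HoleFreePotential
import HarnessLib

/-!
# Lattice Dobrushin domains, II: boxes, the three-sided box and the bar domain

Topic `Literature/Probability/LatticeModels`; second instalment of the realisation of
combinatorial Dobrushin domains of `ℤ²` as the tree's continuum Dobrushin data
(`LatticeDobrushinDomain.lean`), for the Russo–Seymour–Welsh programme of
Duminil-Copin–Hongler–Nolin (arXiv:0912.4253, §4). Everything here is proved ([folklore] lattice
bookkeeping).

* `boxSites a b` and the box datum `LatticeDobrushin.ofBox a b A`: boxes are finite and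
  lattice-connected (`reflTransGen_siteStep_boxSites`), their regular sites are the interior sites
  and their exposed sites the rim (`regular_ofBox_iff`, `exposed_ofBox_iff`,
  `regular_or_exposed_ofBox`), their inner faces are the faces of the box
  (`isInnerFace_ofBox_iff`) and form a hole-free set (`holeFree_isInnerFace_ofBox`); the wired arc
  is preconnected as soon as it is joined by lattice walks (`preconnected_induce_zdArcA`).
* `LatticeDobrushin.threeSided W H`: the sites `[0, W] × [-1, H]` wired on the left, top and
  right sides of `[0, W] × [0, H]` — DCHN's rectangle `(R, c, d)` with free bottom side (proof of
  Lemma 15). Computed: `zdArcA_threeSided`, `zdArcB_threeSided` (the bottom row),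
  `zdABEdges_threeSided` (the two vertical edges below the bottom wired corners),
  `isZdAdmissible_threeSided` (`W, H ≥ 1`), `preconnected_zdArcA_threeSided`, `holeFree_threeSided`.
* `LatticeDobrushin.barDomain W N c`: the sites `[-1, W+1] × [-1, N+1]` (the rectangle
  `R = [0, W] × [0, N]` inside a sacrificial ring) wired on the bar `{c, …, c+3} × {N+1}` — the
  positive-length replacement of DCHN's degenerate domain `(R, u, u)` of Proposition 13. Computed:
  `zdArcA_barDomain`, `zdArcB_barDomain`, `zdABEdges_barDomain`, `isZdAdmissible_barDomain`
  (`0 ≤ c`, `c + 3 ≤ W`), `preconnected_zdArcA_barDomain`, `holeFree_barDomain`,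
  `regular_barDomain_iff` (the regular sites are exactly `R`), `zdBoundary_barDomain`.

## References

* H. Duminil-Copin, C. Hongler, P. Nolin, *Connection probabilities and RSW-type bounds for the
  two-dimensional FK Ising model*, Comm. Pure Appl. Math. 64 (2011) 1165–1198 (arXiv:0912.4253),
  §2.2 and §4 — bib key `DuminilCopinHonglerNolin2011`.
-/

noncomputable section

/-! ## Boxes of sites -/

namespace Literature.Probability.LatticeModels

open Complex Metric Set

/-- The box of sites `{x | a ≤ x ≤ b}` (coordinatewise) of `ℤ²`. [folklore] -/
def boxSites (a b : Site 2) : Set (Site 2) := {x | ∀ i, a i ≤ x i ∧ x i ≤ b i}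

variable {a b : Site 2}

/-- Membership in a box, unfolded. [folklore] -/
theorem mem_boxSites_iff {x : Site 2} : x ∈ boxSites a b ↔ ∀ i, a i ≤ x i ∧ x i ≤ b i := Iff.rfl

/-- Boxes are finite. [folklore] -/
theorem boxSites_finite (a b : Site 2) : (boxSites a b).Finite := by
  refine (Set.Finite.pi (t := fun i : Fin 2 => Set.Icc (a i) (b i)) fun i => Set.finite_Icc _ _).subset ?_
  intro x hx
  rw [Set.mem_univ_pi]
  exact fun i => ⟨(hx i).1, (hx i).2⟩

/-- One lattice step inside the box towards a site of the box. [folklore] -/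
theorem exists_siteStep_boxSites {x y : Site 2} (hx : x ∈ boxSites a b) (hy : y ∈ boxSites a b) (hxy : x ≠ y) :
    ∃ x', SiteStep (boxSites a b) x x' ∧
      (|x' 0 - y 0| + |x' 1 - y 1| : ℤ) < |x 0 - y 0| + |x 1 - y 1| := by
  -- a coordinate where they differ
  obtain ⟨i, hi⟩ : ∃ i, x i ≠ y i := by
    by_contra h
    push Not at h
    exact hxy (funext h)
  rcases lt_or_gt_of_ne hi with hlt | hlt
  · -- step up in the coordinate `i`
    refine ⟨x + Pi.single i 1, ⟨(zdGraph_adj_iff _ _).2 ⟨i, Or.inl rfl⟩, hx, fun j => ?_⟩, ?_⟩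
    · by_cases hji : j = i
      · subst hji; simp; constructor <;> [linarith [(hx j).1]; linarith [(hy j).2]]
      · simp [hji]; exact hx j
    · fin_cases i
      · simp
        have h1 : |x 0 + 1 - y 0| < |x 0 - y 0| := by
          rw [abs_of_nonpos (by simp at hlt; omega), abs_of_neg (by simp at hlt; omega)]; omega
        linarith
      · simp
        have h1 : |x 1 + 1 - y 1| < |x 1 - y 1| := by
          rw [abs_of_nonpos (by simp at hlt; omega), abs_of_neg (by simp at hlt; omega)]; omega
        linarith
  · -- step down in the coordinate `i`
    refine ⟨x - Pi.single i 1, ⟨(zdGraph_adj_iff _ _).2 ⟨i, Or.inr (by simp)⟩, hx, fun j => ?_⟩, ?_⟩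
    · by_cases hji : j = i
      · subst hji; simp; constructor <;> [linarith [(hy j).1]; linarith [(hx j).2]]
      · simp [hji]; exact hx j
    · fin_cases i
      · simp
        have h1 : |x 0 - 1 - y 0| < |x 0 - y 0| := by
          rw [abs_of_nonneg (by simp at hlt; omega), abs_of_pos (by simp at hlt; omega)]; omega
        linarith
      · simp
        have h1 : |x 1 - 1 - y 1| < |x 1 - y 1| := by
          rw [abs_of_nonneg (by simp at hlt; omega), abs_of_pos (by simp at hlt; omega)]; omega
        linarith

/-- **Boxes are lattice-connected**: any two sites of a box are joined by a nearest-neighbour walk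
inside the box. [folklore] -/
theorem reflTransGen_siteStep_boxSites {x y : Site 2} (hx : x ∈ boxSites a b) (hy : y ∈ boxSites a b) :
    Relation.ReflTransGen (SiteStep (boxSites a b)) x y := by
  -- induction on the `ℓ¹` distance
  suffices ∀ n : ℕ, ∀ x, x ∈ boxSites a b → (|x 0 - y 0| + |x 1 - y 1| : ℤ) ≤ n →
      Relation.ReflTransGen (SiteStep (boxSites a b)) x y by
    exact this (|x 0 - y 0| + |x 1 - y 1|).toNat x hx (Int.self_le_toNat _)
  intro n
  induction n with
  | zero =>
    intro x hx hn
    have ha0 := abs_nonneg (x 0 - y 0)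
    have ha1 := abs_nonneg (x 1 - y 1)
    have h0 : x 0 = y 0 := by
      have : |x 0 - y 0| = 0 := by omega
      have := abs_eq_zero.1 this; omega
    have h1 : x 1 = y 1 := by
      have : |x 1 - y 1| = 0 := by omega
      have := abs_eq_zero.1 this; omega
    have : x = y := funext fun i => by fin_cases i <;> assumption
    rw [this]
  | succ n ih =>
    intro x hx hn
    by_cases hxy : x = y
    · rw [hxy]
    · obtain ⟨x', hstep, hlt⟩ := exists_siteStep_boxSites hx hy hxy
      exact Relation.ReflTransGen.head hstep (ih x' hstep.2.2 (by omega))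

namespace LatticeDobrushin

/-- **The combinatorial Dobrushin datum of a box** `{a ≤ x ≤ b}` (nonempty: `a ≤ b`) with wired
sites `A`. [cite: DuminilCopinHonglerNolin2011, §2.2] -/
def ofBox (a b : Site 2) (A : Set (Site 2)) (hA : A ⊆ boxSites a b) : LatticeDobrushin where
  S := boxSites a b
  A := A
  finite := boxSites_finite a b
  conn := fun _ hx _ hy => reflTransGen_siteStep_boxSites hx hy
  A_subset := hA

variable {A : Set (Site 2)} {hA : A ⊆ boxSites a b}

/-- The sites of a box datum. [folklore] -/
@[simp] theorem ofBox_S : (ofBox a b A hA).S = boxSites a b := rfl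

/-- The wired sites of a box datum. [folklore] -/
@[simp] theorem ofBox_A : (ofBox a b A hA).A = A := rfl

/-- **Regular sites of a box are its interior sites.** [folklore] -/
theorem regular_ofBox_iff {x : Site 2} : (ofBox a b A hA).Regular x ↔ ∀ i, a i < x i ∧ x i < b i := by
  constructor
  · intro h i
    have h1 := h (x + Pi.single i 1) (fun j => by by_cases hji : j = i <;> simp [hji])
    have h2 := h (x - Pi.single i 1) (fun j => by by_cases hji : j = i <;> simp [hji])
    have h1i := (h1 i).2
    have h2i := (h2 i).1
    simp at h1i h2i
    constructor <;> omega
  · intro h y hy j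
    have := hy j
    rw [abs_le] at this
    constructor <;> [linarith [(h j).1]; linarith [(h j).2]]

/-- **Exposed sites of a box are the sites on its rim.** [folklore] -/
theorem exposed_ofBox_iff {x : Site 2} (hx : x ∈ boxSites a b) :
    (ofBox a b A hA).Exposed x ↔ ∃ i, x i = a i ∨ x i = b i := by
  constructor
  · rintro ⟨c, hxc, hc⟩
    simp only [ofBox_S, mem_boxSites_iff, not_forall, not_and_or, not_le] at hc
    obtain ⟨i, hi⟩ := hc
    refine ⟨i, ?_⟩
    have h1 := abs_sub_le_one_of_adj hxc i
    rw [abs_le] at h1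
    have := hx i
    rcases hi with hi | hi <;> omega
  · rintro ⟨i, hi | hi⟩
    · refine ⟨x - Pi.single i 1, (zdGraph_adj_iff _ _).2 ⟨i, Or.inr (by simp)⟩, fun h => ?_⟩
      have := (h i).1
      simp at this
      omega
    · refine ⟨x + Pi.single i 1, (zdGraph_adj_iff _ _).2 ⟨i, Or.inl rfl⟩, fun h => ?_⟩
      have := (h i).2
      simp at this
      omega

/-- Every site of a box is regular or exposed. [folklore] -/
theorem regular_or_exposed_ofBox (x : Site 2) (hx : x ∈ (ofBox a b A hA).S) :
    (ofBox a b A hA).Regular x ∨ (ofBox a b A hA).Exposed x := by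
  by_cases h : ∀ i, a i < x i ∧ x i < b i
  · exact Or.inl (regular_ofBox_iff.2 h)
  · right
    rw [exposed_ofBox_iff hx]
    push Not at h
    obtain ⟨i, hi⟩ := h
    refine ⟨i, ?_⟩
    have := hx i
    by_cases h' : a i < x i
    · have := hi h'; omega
    · omega

/-- **The inner faces of a box**: the face with lower-left corner `f` is inner iff
`a ≤ f` and `f + (1,1) ≤ b`. [folklore] -/
theorem isInnerFace_ofBox_iff {f : Site 2} :
    (ofBox a b A hA).toDobrushin.IsInnerFace f ↔ ∀ i, a i ≤ f i ∧ f i + 1 ≤ b i := by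
  rw [LatticeDobrushin.isInnerFace_iff']
  simp only [ofBox_S, mem_boxSites_iff]
  constructor
  · rintro ⟨h1, -, -, h4⟩ i
    refine ⟨(h1 i).1, ?_⟩
    have := (h4 i).2
    fin_cases i <;> simp at this ⊢ <;> omega
  · intro h
    refine ⟨fun i => ⟨(h i).1, by linarith [(h i).2]⟩, fun i => ?_, fun i => ?_, fun i => ?_⟩ <;>
      fin_cases i <;> simp <;> constructor <;> linarith [(h 0).1, (h 0).2, (h 1).1, (h 1).2]

/-- The set of inner faces of a box. [folklore] -/
theorem setOf_isInnerFace_ofBox :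
    {f | (ofBox a b A hA).toDobrushin.IsInnerFace f} = {f | ∀ i, a i ≤ f i ∧ f i + 1 ≤ b i} := by
  ext f; exact isInnerFace_ofBox_iff

/-- A vertical chain of face steps outside a set of faces. [folklore] -/
theorem reflTransGen_faceStep_up {P : Set (Site 2)} {g : Site 2} (h : ∀ k : ℕ, g + k • Pi.single 1 1 ∉ P) (K : ℕ) :
    Relation.ReflTransGen (FaceStep P) g (g + K • Pi.single 1 1) := by
  induction K with
  | zero => simp only [zero_nsmul, add_zero]; exact Relation.ReflTransGen.refl
  | succ K ih =>
    refine ih.tail ⟨(zdGraph_adj_iff _ _).2 ⟨1, Or.inl ?_⟩, h K, h (K + 1)⟩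
    rw [succ_nsmul, add_assoc]

/-- A horizontal chain of face steps (to the left) outside a set of faces. [folklore] -/
theorem reflTransGen_faceStep_left {P : Set (Site 2)} {g : Site 2} (h : ∀ k : ℕ, g - k • Pi.single 0 1 ∉ P) (K : ℕ) :
    Relation.ReflTransGen (FaceStep P) g (g - K • Pi.single 0 1) := by
  induction K with
  | zero => simp only [zero_nsmul, sub_zero]; exact Relation.ReflTransGen.refl
  | succ K ih =>
    refine ih.tail ⟨(zdGraph_adj_iff _ _).2 ⟨0, Or.inr ?_⟩, h K, h (K + 1)⟩
    rw [succ_nsmul, sub_add_eq_sub_sub, sub_add_cancel]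

/-- **The inner faces of a box form a hole-free set**: a face outside escapes upwards, first moving
left below the box if it lies under it. [folklore] -/
theorem holeFree_isInnerFace_ofBox : HoleFree {f | (ofBox a b A hA).toDobrushin.IsInnerFace f} := by
  rw [setOf_isInnerFace_ofBox]
  intro g hg M
  simp only [mem_setOf_eq, not_forall, not_and_or, not_le] at hg
  obtain ⟨i, hi⟩ := hg
  -- Case 1: the column above `g` is free (left/right of the box, or above it)
  by_cases hcol : g 0 < a 0 ∨ b 0 < g 0 + 1 ∨ b 1 < g 1 + 1
  · have hfree : ∀ k : ℕ, g + k • Pi.single 1 1 ∉ {f : Site 2 | ∀ i, a i ≤ f i ∧ f i + 1 ≤ b i} := by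
      intro k hk
      have h0 := hk 0; have h1 := hk 1
      simp at h0 h1
      omega
    refine ⟨g + (M - g 1).toNat • Pi.single 1 1, ?_, reflTransGen_faceStep_up hfree _⟩
    simp
    have := Int.self_le_toNat (M - g 1)
    omega
  · -- Case 2: `g` lies below the box (within its horizontal range): go left, then up
    push Not at hcol
    obtain ⟨h0a, h0b, h1b⟩ := hcol
    have hbelow : g 1 < a 1 := by
      rcases hi with hi | hi
      · fin_cases i <;> simp at hi <;> omega
      · fin_cases i <;> simp at hi <;> omega
    set K : ℕ := (g 0 - a 0 + 1).toNat with hK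
    have hfreeL : ∀ k : ℕ, g - k • Pi.single 0 1 ∉ {f : Site 2 | ∀ i, a i ≤ f i ∧ f i + 1 ≤ b i} := by
      intro k hk
      have h1 := hk 1
      simp at h1
      omega
    set g' : Site 2 := g - K • Pi.single 0 1 with hg'
    have hg'0 : g' 0 < a 0 := by
      rw [hg']; simp
      have := Int.self_le_toNat (g 0 - a 0 + 1)
      omega
    have hfreeU : ∀ k : ℕ, g' + k • Pi.single 1 1 ∉ {f : Site 2 | ∀ i, a i ≤ f i ∧ f i + 1 ≤ b i} := by
      intro k hk
      have h0 := hk 0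
      simp [hg'] at h0 hg'0
      omega
    refine ⟨g' + (M - g' 1).toNat • Pi.single 1 1, ?_,
      (reflTransGen_faceStep_left hfreeL K).trans (reflTransGen_faceStep_up hfreeU _)⟩
    simp
    have := Int.self_le_toNat (M - g' 1)
    omega

/-- **Preconnectedness of the wired arc from lattice walks**: if the discrete wired arc is a set
`T` any two sites of which are joined by nearest-neighbour walks inside `T`, the domain graph
induced on it is preconnected (hypothesis (H1) of the observable machinery). [folklore] -/
theorem preconnected_induce_zdArcA (L : LatticeDobrushin) {T : Set (Site 2)} (hT : L.toDobrushin.zdArcA = T)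
    (hTS : T ⊆ L.S) (hjoin : ∀ x ∈ T, ∀ y ∈ T, Relation.ReflTransGen (SiteStep T) x y) :
    ((discreteDomainGraph L.toDobrushin.Ω L.toDobrushin.δ).induce L.toDobrushin.zdArcA).Preconnected := by
  subst hT
  intro u v
  have key : ∀ (x : Site 2) (hx : x ∈ L.toDobrushin.zdArcA) (y : Site 2),
      Relation.ReflTransGen (SiteStep L.toDobrushin.zdArcA) x y → ∀ hy : y ∈ L.toDobrushin.zdArcA,
      ((discreteDomainGraph L.toDobrushin.Ω L.toDobrushin.δ).induce L.toDobrushin.zdArcA).Reachable ⟨x, hx⟩ ⟨y, hy⟩ := by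
    intro x hx y h
    induction h with
    | refl => intro; exact SimpleGraph.Reachable.refl _
    | @tail b c _ hbc ih =>
      intro hc
      refine (ih hbc.2.1).trans (SimpleGraph.Adj.reachable ?_)
      rw [SimpleGraph.induce_adj]
      exact L.adj_iff.2 ⟨hbc.1, hTS hbc.2.1, hTS hbc.2.2⟩
  exact key u.1 u.2 v.1 (hjoin u.1 u.2 v.1 v.2) v.2

end LatticeDobrushin

end Literature.Probability.LatticeModels

namespace Literature.Probability.LatticeModels

open Complex Metric Set

/-! ### Walks along lattice lines; faces at an edge -/

/-- A straight lattice walk inside `T` in the direction `+eᵢ`. [folklore] -/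
theorem reflTransGen_siteStep_line {T : Set (Site 2)} (x : Site 2) (i : Fin 2) (n : ℕ)
    (h : ∀ k : ℕ, k ≤ n → x + (k : ℤ) • (Pi.single i 1 : Site 2) ∈ T) :
    Relation.ReflTransGen (SiteStep T) x (x + (n : ℤ) • (Pi.single i 1 : Site 2)) := by
  induction n with
  | zero => simp only [Nat.cast_zero, zero_smul, add_zero]; exact Relation.ReflTransGen.refl
  | succ n ih =>
    refine (ih fun k hk => h k (by omega)).tail ⟨(zdGraph_adj_iff _ _).2 ⟨i, Or.inl ?_⟩, h n (by omega), ?_⟩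
    · push_cast; rw [add_smul, one_smul, add_assoc]
    · exact h (n + 1) le_rfl

/-- A straight lattice walk inside `T` in the direction `-eᵢ`. [folklore] -/
theorem reflTransGen_siteStep_line_neg {T : Set (Site 2)} (x : Site 2) (i : Fin 2) (n : ℕ)
    (h : ∀ k : ℕ, k ≤ n → x - (k : ℤ) • (Pi.single i 1 : Site 2) ∈ T) :
    Relation.ReflTransGen (SiteStep T) x (x - (n : ℤ) • (Pi.single i 1 : Site 2)) := by
  induction n with
  | zero => simp only [Nat.cast_zero, zero_smul, sub_zero]; exact Relation.ReflTransGen.refl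
  | succ n ih =>
    refine (ih fun k hk => h k (by omega)).tail ⟨(zdGraph_adj_iff _ _).2 ⟨i, Or.inr ?_⟩, h n (by omega), ?_⟩
    · push_cast; rw [add_smul, one_smul, sub_add_eq_sub_sub, sub_add_cancel]
    · exact h (n + 1) le_rfl

/-- Lattice steps inside a set are symmetric, hence walks can be reversed. [folklore] -/
theorem reflTransGen_siteStep_reverse {T : Set (Site 2)} {x y : Site 2} (h : Relation.ReflTransGen (SiteStep T) x y) :
    Relation.ReflTransGen (SiteStep T) y x := by
  induction h with
  | refl => exact Relation.ReflTransGen.refl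
  | tail _ hbc ih => exact Relation.ReflTransGen.head ⟨hbc.1.symm, hbc.2.2, hbc.2.1⟩ ih

/-- The faces having both endpoints of the horizontal edge `{x, x + e₀}` as corners are the face
above it (lower-left corner `x`) and the face below it (lower-left corner `x - e₁`). [folklore] -/
theorem isCorner_and_isCorner_add_e0_iff {x f : Site 2} :
    (IsCorner x f ∧ IsCorner (x + Pi.single 0 1) f) ↔ (f = x ∨ f = x - Pi.single 1 1) := by
  have e0 : faceAt x 0 = x := by simp [faceAt, cornerOff]
  have e3 : faceAt x 3 = x - Pi.single 1 1 := by simp [faceAt, cornerOff]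
  have u0 : (cornerUnit 0 : Site 2) = Pi.single 0 1 := rfl
  constructor
  · rintro ⟨hx, hy⟩
    obtain ⟨j, rfl⟩ := exists_faceAt_of_isCorner hx
    rw [← u0] at hy
    rcases (isCorner_add_faceAt_iff x 0 j).1 hy with rfl | rfl
    · left; exact e0
    · right; exact e3
  · rintro (rfl | rfl)
    · refine ⟨?_, ?_⟩
      · rw [← e0]; exact e0.symm ▸ isCorner_faceAt f 0
      · have := (isCorner_add_faceAt_iff f 0 0).2 (Or.inl rfl)
        rwa [u0, show faceAt f 0 = f by simp [faceAt, cornerOff]] at this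
    · refine ⟨e3 ▸ isCorner_faceAt x 3, ?_⟩
      have := (isCorner_add_faceAt_iff x 0 3).2 (Or.inr rfl)
      rwa [u0, e3] at this

/-- The faces having both endpoints of the vertical edge `{x, x + e₁}` as corners are the face to
its right (lower-left corner `x`) and the face to its left (lower-left corner `x - e₀`). [folklore] -/
theorem isCorner_and_isCorner_add_e1_iff {x f : Site 2} :
    (IsCorner x f ∧ IsCorner (x + Pi.single 1 1) f) ↔ (f = x ∨ f = x - Pi.single 0 1) := by
  have e1 : faceAt x 1 = x - Pi.single 0 1 := by simp [faceAt, cornerOff]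
  have e4 : faceAt x (1 + 3) = x := by simp [faceAt, cornerOff]
  have u1 : (cornerUnit 1 : Site 2) = Pi.single 1 1 := rfl
  constructor
  · rintro ⟨hx, hy⟩
    obtain ⟨j, rfl⟩ := exists_faceAt_of_isCorner hx
    rw [← u1] at hy
    rcases (isCorner_add_faceAt_iff x 1 j).1 hy with rfl | rfl
    · right; exact e1
    · left; exact e4
  · rintro (rfl | rfl)
    · refine ⟨isCorner_self f, ?_⟩
      have := (isCorner_add_faceAt_iff f 1 (1 + 3)).2 (Or.inr rfl)
      rwa [u1, show faceAt f (1 + 3) = f by simp [faceAt, cornerOff]] at this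
    · refine ⟨e1 ▸ isCorner_faceAt x 1, ?_⟩
      have := (isCorner_add_faceAt_iff x 1 1).2 (Or.inl rfl)
      rwa [u1, e1] at this

namespace LatticeDobrushin

/-! ### The three-sided box: a rectangle wired on its left, top and right sides -/

/-- **The three-sided box** of width `W` and height `H`: the sites `[0, W] × [-1, H]`, wired on the
left column, the top row and the right column of `[0, W] × [0, H]`; the bottom row `[0, W] × {-1}`
is the sacrificial free arc. This is Duminil-Copin–Hongler–Nolin's Dobrushin domain
`(R, c, d)` — a rectangle with free boundary conditions on its bottom side and wired boundary
conditions on the three other sides (proof of Lemma 15), in the tree's rendering.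
[cite: DuminilCopinHonglerNolin2011, §4, proof of Lemma 15] -/
def threeSided (W H : ℕ) : LatticeDobrushin :=
  ofBox ![0, -1] ![(W : ℤ), (H : ℤ)]
    {x | x ∈ boxSites ![0, -1] ![(W : ℤ), (H : ℤ)] ∧ 0 ≤ x 1 ∧ (x 0 = 0 ∨ x 0 = W ∨ x 1 = H)} fun _ h => h.1

variable {W H : ℕ}

/-- The sites of the three-sided box. [folklore] -/
theorem mem_threeSided_S {x : Site 2} : x ∈ (threeSided W H).S ↔ 0 ≤ x 0 ∧ x 0 ≤ (W : ℤ) ∧ -1 ≤ x 1 ∧ x 1 ≤ (H : ℤ) := by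
  simp [threeSided, ofBox_S, mem_boxSites_iff, Fin.forall_fin_two]
  tauto

/-- The wired sites of the three-sided box. [folklore] -/
theorem mem_threeSided_A {x : Site 2} :
    x ∈ (threeSided W H).A ↔ (0 ≤ x 0 ∧ x 0 ≤ (W : ℤ) ∧ -1 ≤ x 1 ∧ x 1 ≤ (H : ℤ)) ∧ 0 ≤ x 1 ∧
      (x 0 = 0 ∨ x 0 = (W : ℤ) ∨ x 1 = (H : ℤ)) := by
  simp [threeSided, ofBox_A, mem_boxSites_iff, Fin.forall_fin_two]
  tauto

/-- Exposed sites of the three-sided box. [folklore] -/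
theorem exposed_threeSided_iff {x : Site 2} (hx : x ∈ (threeSided W H).S) :
    (threeSided W H).Exposed x ↔ x 0 = 0 ∨ x 0 = (W : ℤ) ∨ x 1 = -1 ∨ x 1 = (H : ℤ) := by
  rw [threeSided, exposed_ofBox_iff (by exact hx)]
  simp [Fin.exists_fin_two]
  tauto

/-- Every wired site of the three-sided box is exposed. [folklore] -/
theorem exposed_of_mem_threeSided_A {x : Site 2} (hx : x ∈ (threeSided W H).A) : (threeSided W H).Exposed x := by
  have hx' := mem_threeSided_A.1 hx
  rw [exposed_threeSided_iff (mem_threeSided_S.2 hx'.1)]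
  tauto

/-- The bottom-left wired corner is an exposed wired site. [folklore] -/
theorem exists_exposed_A_threeSided : ∃ a ∈ (threeSided W H).A, (threeSided W H).Exposed a :=
  ⟨![0, 0], by simp [mem_threeSided_A], by rw [exposed_threeSided_iff (by simp [mem_threeSided_S])]; simp⟩

/-- The site below the bottom-left corner is an exposed non-wired site. [folklore] -/
theorem exists_exposed_B_threeSided :
    ∃ b ∈ (threeSided W H).S, b ∉ (threeSided W H).A ∧ (threeSided W H).Exposed b :=
  ⟨![0, -1], by simp [mem_threeSided_S], by simp [mem_threeSided_A],
    by rw [exposed_threeSided_iff (by simp [mem_threeSided_S])]; simp⟩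

/-- **The discrete wired arc of the three-sided box is its set of wired sites.** [folklore] -/
theorem zdArcA_threeSided : (threeSided W H).toDobrushin.zdArcA = (threeSided W H).A := by
  rw [(threeSided W H).zdArcA_eq (regular_or_exposed_ofBox) exists_exposed_A_threeSided exists_exposed_B_threeSided]
  ext x
  exact ⟨fun h => h.1, fun h => ⟨h, exposed_of_mem_threeSided_A h⟩⟩

/-- **The discrete arc `B` of the three-sided box is its bottom row.** [folklore] -/
theorem zdArcB_threeSided : (threeSided W H).toDobrushin.zdArcB = {x | 0 ≤ x 0 ∧ x 0 ≤ (W : ℤ) ∧ x 1 = -1} := by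
  rw [(threeSided W H).zdArcB_eq (regular_or_exposed_ofBox) exists_exposed_A_threeSided exists_exposed_B_threeSided]
  ext x
  simp only [mem_setOf_eq]
  constructor
  · rintro ⟨hxS, hxA, hexp⟩
    rw [exposed_threeSided_iff hxS] at hexp
    rw [mem_threeSided_S] at hxS
    rw [mem_threeSided_A] at hxA
    refine ⟨hxS.1, hxS.2.1, ?_⟩
    by_contra h1
    exact hxA ⟨hxS, by omega, by omega⟩
  · rintro ⟨h0, h0', h1⟩
    have hxS : x ∈ (threeSided W H).S := mem_threeSided_S.2 ⟨h0, h0', by omega, by omega⟩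
    refine ⟨hxS, fun hA => ?_, (exposed_threeSided_iff hxS).2 (Or.inr (Or.inr (Or.inl h1)))⟩
    have := (mem_threeSided_A.1 hA).2.1; omega

/-- The two arcs of the three-sided box are disjoint. [folklore] -/
theorem disjoint_arcs_threeSided : Disjoint (threeSided W H).toDobrushin.zdArcA (threeSided W H).toDobrushin.zdArcB :=
  (threeSided W H).disjoint_zdArcA_zdArcB regular_or_exposed_ofBox exists_exposed_A_threeSided exists_exposed_B_threeSided

/-- **The two `A`–`B` edges of the three-sided box**: the vertical edges below its two bottom
wired corners `(0, 0)` and `(W, 0)` (for `H ≥ 1`). [folklore] -/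
theorem zdABEdges_threeSided (hH : 1 ≤ H) :
    (threeSided W H).toDobrushin.zdABEdges = {s(![0, 0], ![0, -1]), s(![(W : ℤ), 0], ![(W : ℤ), -1])} := by
  ext e
  induction e using Sym2.ind with
  | h x y =>
  rw [(threeSided W H).mem_zdABEdges_iff regular_or_exposed_ofBox exists_exposed_A_threeSided exists_exposed_B_threeSided]
  simp only [mem_insert_iff, mem_singleton_iff]
  constructor
  · rintro ⟨hadj, h⟩
    -- normalise to `x ∈ A`, `y` on the arc `B`
    have key : ∀ x y : Site 2, (zdGraph 2).Adj x y → x ∈ (threeSided W H).A → y ∈ (threeSided W H).S →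
        y ∉ (threeSided W H).A → (threeSided W H).Exposed y →
        (x = ![0, 0] ∧ y = ![0, -1]) ∨ (x = ![(W : ℤ), 0] ∧ y = ![(W : ℤ), -1]) := by
      intro x y hadj hxA hyS hyA hye
      have hyB : y ∈ (threeSided W H).toDobrushin.zdArcB := by
        rw [(threeSided W H).zdArcB_eq regular_or_exposed_ofBox exists_exposed_A_threeSided exists_exposed_B_threeSided]
        exact ⟨hyS, hyA, hye⟩
      rw [zdArcB_threeSided] at hyB
      obtain ⟨hy0, hy0', hy1⟩ := hyB
      obtain ⟨⟨hx0, hx0', hx1, hx1'⟩, hx1'', hxrim⟩ := mem_threeSided_A.1 hxA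
      have hd0 := abs_sub_le_one_of_adj hadj 0
      have hd1 := abs_sub_le_one_of_adj hadj 1
      rw [abs_le] at hd0 hd1
      obtain ⟨i, hi | hi⟩ := (zdGraph_adj_iff x y).1 hadj
      · have h0 := congrFun hi 0; have h1 := congrFun hi 1
        fin_cases i <;> simp at h0 h1 <;> omega
      · have h0 := congrFun hi 0; have h1 := congrFun hi 1
        fin_cases i
        · simp at h0 h1; omega
        · simp at h0 h1
          have hx1z : x 1 = 0 := by omega
          rcases hxrim with h | h | h
          · left; constructor <;> (funext j; fin_cases j <;> simp <;> omega)
          · right; constructor <;> (funext j; fin_cases j <;> simp <;> omega)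
          · omega
    rcases h with ⟨hxA, -, hyS, hyA, hye⟩ | ⟨hyA, -, hxS, hxA, hxe⟩
    · rcases key x y hadj hxA hyS hyA hye with ⟨rfl, rfl⟩ | ⟨rfl, rfl⟩
      · exact Or.inl rfl
      · exact Or.inr rfl
    · rcases key y x hadj.symm hyA hxS hxA hxe with ⟨rfl, rfl⟩ | ⟨rfl, rfl⟩
      · exact Or.inl Sym2.eq_swap
      · exact Or.inr Sym2.eq_swap
  · -- the two edges are `A`–`B` edges
    have hA0 : (![0, 0] : Site 2) ∈ (threeSided W H).A := by simp [mem_threeSided_A]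
    have hAW : (![(W : ℤ), 0] : Site 2) ∈ (threeSided W H).A := by simp [mem_threeSided_A]
    have hB0 : (![0, -1] : Site 2) ∈ (threeSided W H).S ∧ (![0, -1] : Site 2) ∉ (threeSided W H).A ∧
        (threeSided W H).Exposed ![0, -1] :=
      ⟨by simp [mem_threeSided_S], by simp [mem_threeSided_A], by rw [exposed_threeSided_iff (by simp [mem_threeSided_S])]; simp⟩
    have hBW : (![(W : ℤ), -1] : Site 2) ∈ (threeSided W H).S ∧ (![(W : ℤ), -1] : Site 2) ∉ (threeSided W H).A ∧
        (threeSided W H).Exposed ![(W : ℤ), -1] :=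
      ⟨by simp [mem_threeSided_S], by simp [mem_threeSided_A], by rw [exposed_threeSided_iff (by simp [mem_threeSided_S])]; simp⟩
    have hadj0 : (zdGraph 2).Adj (![0, 0] : Site 2) ![0, -1] :=
      (zdGraph_adj_iff _ _).2 ⟨1, Or.inr (by funext j; fin_cases j <;> simp)⟩
    have hadjW : (zdGraph 2).Adj (![(W : ℤ), 0] : Site 2) ![(W : ℤ), -1] :=
      (zdGraph_adj_iff _ _).2 ⟨1, Or.inr (by funext j; fin_cases j <;> simp)⟩
    rintro (h | h) <;> rw [Sym2.eq_iff] at h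
    · rcases h with ⟨rfl, rfl⟩ | ⟨rfl, rfl⟩
      · exact ⟨hadj0, Or.inl ⟨hA0, exposed_of_mem_threeSided_A hA0, hB0⟩⟩
      · exact ⟨hadj0.symm, Or.inr ⟨hA0, exposed_of_mem_threeSided_A hA0, hB0⟩⟩
    · rcases h with ⟨rfl, rfl⟩ | ⟨rfl, rfl⟩
      · exact ⟨hadjW, Or.inl ⟨hAW, exposed_of_mem_threeSided_A hAW, hBW⟩⟩
      · exact ⟨hadjW.symm, Or.inr ⟨hAW, exposed_of_mem_threeSided_A hAW, hBW⟩⟩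

/-- Inner faces of the three-sided box. [folklore] -/
theorem isInnerFace_threeSided_iff {f : Site 2} :
    (threeSided W H).toDobrushin.IsInnerFace f ↔ 0 ≤ f 0 ∧ f 0 + 1 ≤ (W : ℤ) ∧ -1 ≤ f 1 ∧ f 1 + 1 ≤ (H : ℤ) := by
  rw [threeSided, isInnerFace_ofBox_iff]
  simp [Fin.forall_fin_two]
  tauto

/-- **Each `A`–`B` edge of the three-sided box is a side of exactly one inner face** (the face of
the bottom strip next to it; `W ≥ 1`). [folklore] -/
theorem zdABEdges_inner_threeSided (hW : 1 ≤ W) (hH : 1 ≤ H) :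
    ∀ e ∈ (threeSided W H).toDobrushin.zdABEdges, ∃! f, (threeSided W H).toDobrushin.IsInnerFace f ∧ ∀ x ∈ e, IsCorner x f := by
  rw [zdABEdges_threeSided hH]
  have hv0 : (![0, 0] : Site 2) = ![0, -1] + Pi.single 1 1 := by funext j; fin_cases j <;> simp
  have hvW : (![(W : ℤ), 0] : Site 2) = ![(W : ℤ), -1] + Pi.single 1 1 := by funext j; fin_cases j <;> simp
  rintro e (rfl | rfl)
  · -- the edge below `(0, 0)`: the face with lower-left corner `(0, -1)`
    refine ⟨![0, -1], ⟨isInnerFace_threeSided_iff.2 (by simp; omega), ?_⟩, ?_⟩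
    · intro x hx
      rcases Sym2.mem_iff.1 hx with rfl | rfl
      · rw [hv0]; exact (isCorner_and_isCorner_add_e1_iff.2 (Or.inl rfl)).2
      · exact isCorner_self _
    · rintro f ⟨hf, hc⟩
      have h1 : IsCorner (![0, -1] : Site 2) f := hc _ (Sym2.mem_mk_right _ _)
      have h2 : IsCorner ((![0, -1] : Site 2) + Pi.single 1 1) f := by rw [← hv0]; exact hc _ (Sym2.mem_mk_left _ _)
      rcases isCorner_and_isCorner_add_e1_iff.1 ⟨h1, h2⟩ with rfl | rfl
      · rfl
      · exfalso
        have := (isInnerFace_threeSided_iff.1 hf).1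
        simp at this
  · -- the edge below `(W, 0)`: the face with lower-left corner `(W - 1, -1)`
    refine ⟨![(W : ℤ), -1] - Pi.single 0 1, ⟨isInnerFace_threeSided_iff.2 (by simp; omega), ?_⟩, ?_⟩
    · intro x hx
      rcases Sym2.mem_iff.1 hx with rfl | rfl
      · rw [hvW]; exact (isCorner_and_isCorner_add_e1_iff.2 (Or.inr rfl)).2
      · exact (isCorner_and_isCorner_add_e1_iff (x := ![(W : ℤ), -1]).2 (Or.inr rfl)).1
    · rintro f ⟨hf, hc⟩
      have h1 : IsCorner (![(W : ℤ), -1] : Site 2) f := hc _ (Sym2.mem_mk_right _ _)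
      have h2 : IsCorner ((![(W : ℤ), -1] : Site 2) + Pi.single 1 1) f := by rw [← hvW]; exact hc _ (Sym2.mem_mk_left _ _)
      rcases isCorner_and_isCorner_add_e1_iff.1 ⟨h1, h2⟩ with rfl | rfl
      · exfalso
        have := (isInnerFace_threeSided_iff.1 hf).2.1
        simp at this
      · rfl

/-- **The three-sided box is admissible Dobrushin data** (`W, H ≥ 1`). [folklore] -/
theorem isZdAdmissible_threeSided (hW : 1 ≤ W) (hH : 1 ≤ H) : (threeSided W H).toDobrushin.IsZdAdmissible := by
  refine (threeSided W H).isZdAdmissible_of disjoint_arcs_threeSided ?_ ?_ ?_ (zdABEdges_inner_threeSided hW hH)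
  · rw [zdArcA_threeSided]; exact ⟨_, exists_exposed_A_threeSided.choose_spec.1⟩
  · rw [zdArcB_threeSided]; exact ⟨![0, -1], by simp⟩
  · rw [zdABEdges_threeSided hH]
    refine Set.ncard_pair fun h => ?_
    have := congrArg (fun e : Sym2 (Site 2) => (![0, 0] : Site 2) ∈ e) h
    simp only [Sym2.mem_iff, eq_iff_iff, true_or, true_iff] at this
    rcases this with h' | h'
    · have := congrFun h' 0; simp at this; omega
    · have := congrFun h' 1; simp at this

/-- **The wired arc of the three-sided box is connected** (hypothesis (H1) of the observable
machinery): any wired site is joined to the top-left corner inside the wired arc. [folklore] -/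
theorem preconnected_zdArcA_threeSided :
    ((discreteDomainGraph (threeSided W H).toDobrushin.Ω (threeSided W H).toDobrushin.δ).induce
      (threeSided W H).toDobrushin.zdArcA).Preconnected := by
  refine (threeSided W H).preconnected_induce_zdArcA zdArcA_threeSided (threeSided W H).A_subset fun x hx y hy => ?_
  -- every wired site is joined to the top-left corner `(0, H)`
  have topath : ∀ x ∈ (threeSided W H).A, Relation.ReflTransGen (SiteStep (threeSided W H).A) x ![0, (H : ℤ)] := by
    intro x hx
    obtain ⟨⟨hx0, hx0', hx1, hx1'⟩, hx1'', hrim⟩ := mem_threeSided_A.1 hx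
    -- first go up to the top row
    have hup : Relation.ReflTransGen (SiteStep (threeSided W H).A) x (x + ((H : ℤ) - x 1).toNat • (Pi.single 1 1 : Site 2)) := by
      rcases hrim with h | h | h
      · refine reflTransGen_siteStep_line x 1 _ fun k hk => mem_threeSided_A.2 ?_
        have := Int.toNat_of_nonneg (show (0 : ℤ) ≤ H - x 1 by omega)
        simp; omega
      · refine reflTransGen_siteStep_line x 1 _ fun k hk => mem_threeSided_A.2 ?_
        have := Int.toNat_of_nonneg (show (0 : ℤ) ≤ H - x 1 by omega)
        simp; omega
      · have h0 : ((H : ℤ) - x 1).toNat = 0 := by rw [h]; simp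
        rw [h0]; simp only [zero_smul, add_zero]; exact Relation.ReflTransGen.refl
    set x' : Site 2 := x + (((H : ℤ) - x 1).toNat : ℤ) • (Pi.single 1 1 : Site 2) with hx'
    have hx'1 : x' 1 = H := by
      have := Int.toNat_of_nonneg (show (0 : ℤ) ≤ H - x 1 by omega)
      simp [hx']; omega
    have hx'0 : x' 0 = x 0 := by simp [hx']
    -- then go left along the top row
    have hleft : Relation.ReflTransGen (SiteStep (threeSided W H).A) x' (x' - ((x' 0).toNat : ℤ) • (Pi.single 0 1 : Site 2)) := by
      refine reflTransGen_siteStep_line_neg x' 0 _ fun k hk => mem_threeSided_A.2 ?_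
      have := Int.toNat_of_nonneg (show (0 : ℤ) ≤ x' 0 by omega)
      simp [hx'1]; omega
    have hend : x' - ((x' 0).toNat : ℤ) • (Pi.single 0 1 : Site 2) = ![0, (H : ℤ)] := by
      have := Int.toNat_of_nonneg (show (0 : ℤ) ≤ x' 0 by omega)
      funext j; fin_cases j
      · simp; omega
      · simp [hx'1]
    rw [hend] at hleft
    exact hup.trans hleft
  exact (topath x hx).trans (reflTransGen_siteStep_reverse (topath y hy))

/-- The inner faces of the three-sided box form a hole-free set. [folklore] -/
theorem holeFree_threeSided : HoleFree {f | (threeSided W H).toDobrushin.IsInnerFace f} :=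
  holeFree_isInnerFace_ofBox

end LatticeDobrushin

end Literature.Probability.LatticeModels

namespace Literature.Probability.LatticeModels

open Complex Metric Set

namespace LatticeDobrushin

/-! ### The bar domain: a free rectangle with a short wired bar above its top side -/

/-- **The bar domain**: the sites `[-1, W+1] × [-1, N+1]` — the rectangle `R = [0, W] × [0, N]`
surrounded by a sacrificial ring — wired on the four ring sites `(c, N+1), …, (c+3, N+1)` above the
top side of `R` (the *bar*); the rest of the ring is the free arc `B`. Deleting the edges at `B`
leaves the graph `R` together with the wired bar attached to the four sites `(c, N), …, (c+3, N)`
of the top side of `R` by four free edges: up to finite-energy factors, connection to the bar in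
this Dobrushin domain is connection to a site of the top side in `R` with free boundary conditions
— the replacement for Duminil-Copin–Hongler–Nolin's degenerate Dobrushin domain `(R, u, u)` of
Proposition 13 / Lemma 9 that keeps a wired arc of positive length.
[cite: DuminilCopinHonglerNolin2011, §4, Proposition 13] -/
def barDomain (W N : ℕ) (c : ℤ) : LatticeDobrushin :=
  ofBox ![-1, -1] ![(W : ℤ) + 1, (N : ℤ) + 1]
    {x | x ∈ boxSites ![-1, -1] ![(W : ℤ) + 1, (N : ℤ) + 1] ∧ x 1 = N + 1 ∧ c ≤ x 0 ∧ x 0 ≤ c + 3} fun _ h => h.1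

variable {W N : ℕ} {c : ℤ}

/-- The sites of the bar domain. [folklore] -/
theorem mem_barDomain_S {x : Site 2} :
    x ∈ (barDomain W N c).S ↔ -1 ≤ x 0 ∧ x 0 ≤ (W : ℤ) + 1 ∧ -1 ≤ x 1 ∧ x 1 ≤ (N : ℤ) + 1 := by
  simp [barDomain, ofBox_S, mem_boxSites_iff, Fin.forall_fin_two]
  tauto

/-- The wired sites of the bar domain (the bar). [folklore] -/
theorem mem_barDomain_A {x : Site 2} :
    x ∈ (barDomain W N c).A ↔ (-1 ≤ x 0 ∧ x 0 ≤ (W : ℤ) + 1 ∧ -1 ≤ x 1 ∧ x 1 ≤ (N : ℤ) + 1) ∧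
      x 1 = N + 1 ∧ c ≤ x 0 ∧ x 0 ≤ c + 3 := by
  simp [barDomain, ofBox_A, mem_boxSites_iff, Fin.forall_fin_two]
  tauto

/-- Exposed sites of the bar domain: the ring. [folklore] -/
theorem exposed_barDomain_iff {x : Site 2} (hx : x ∈ (barDomain W N c).S) :
    (barDomain W N c).Exposed x ↔ x 0 = -1 ∨ x 0 = (W : ℤ) + 1 ∨ x 1 = -1 ∨ x 1 = (N : ℤ) + 1 := by
  rw [barDomain, exposed_ofBox_iff (by exact hx)]
  simp [Fin.exists_fin_two]
  tauto

/-- Every site of the bar is exposed. [folklore] -/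
theorem exposed_of_mem_barDomain_A {x : Site 2} (hx : x ∈ (barDomain W N c).A) : (barDomain W N c).Exposed x := by
  have hx' := mem_barDomain_A.1 hx
  rw [exposed_barDomain_iff (mem_barDomain_S.2 hx'.1)]
  exact Or.inr (Or.inr (Or.inr hx'.2.1))

/-- The leftmost bar site is an exposed wired site (`0 ≤ c`, `c + 3 ≤ W`). [folklore] -/
theorem exists_exposed_A_barDomain (hc : 0 ≤ c) (hcW : c + 3 ≤ W) :
    ∃ a ∈ (barDomain W N c).A, (barDomain W N c).Exposed a := by
  refine ⟨![c, (N : ℤ) + 1], ?_, ?_⟩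
  · rw [mem_barDomain_A]; simp; omega
  · rw [exposed_barDomain_iff (by rw [mem_barDomain_S]; simp; omega)]; simp

/-- The bottom-left ring corner is an exposed non-wired site. [folklore] -/
theorem exists_exposed_B_barDomain :
    ∃ b ∈ (barDomain W N c).S, b ∉ (barDomain W N c).A ∧ (barDomain W N c).Exposed b :=
  ⟨![-1, -1], by simp [mem_barDomain_S]; omega, by simp [mem_barDomain_A]; omega,
    by rw [exposed_barDomain_iff (by simp [mem_barDomain_S]; omega)]; simp⟩

/-- **The discrete wired arc of the bar domain is the bar.** [folklore] -/
theorem zdArcA_barDomain (hc : 0 ≤ c) (hcW : c + 3 ≤ W) : (barDomain W N c).toDobrushin.zdArcA = (barDomain W N c).A := by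
  rw [(barDomain W N c).zdArcA_eq regular_or_exposed_ofBox (exists_exposed_A_barDomain hc hcW) exists_exposed_B_barDomain]
  ext x
  exact ⟨fun h => h.1, fun h => ⟨h, exposed_of_mem_barDomain_A h⟩⟩

/-- **The discrete arc `B` of the bar domain is the ring minus the bar.** [folklore] -/
theorem zdArcB_barDomain (hc : 0 ≤ c) (hcW : c + 3 ≤ W) :
    (barDomain W N c).toDobrushin.zdArcB = {x | x ∈ (barDomain W N c).S ∧
      (x 0 = -1 ∨ x 0 = (W : ℤ) + 1 ∨ x 1 = -1 ∨ x 1 = (N : ℤ) + 1) ∧ ¬ (x 1 = N + 1 ∧ c ≤ x 0 ∧ x 0 ≤ c + 3)} := by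
  rw [(barDomain W N c).zdArcB_eq regular_or_exposed_ofBox (exists_exposed_A_barDomain hc hcW) exists_exposed_B_barDomain]
  ext x
  simp only [mem_setOf_eq]
  constructor
  · rintro ⟨hxS, hxA, hexp⟩
    refine ⟨hxS, (exposed_barDomain_iff hxS).1 hexp, fun h => hxA (mem_barDomain_A.2 ⟨mem_barDomain_S.1 hxS, h⟩)⟩
  · rintro ⟨hxS, hrim, hnot⟩
    exact ⟨hxS, fun h => hnot (mem_barDomain_A.1 h).2, (exposed_barDomain_iff hxS).2 hrim⟩

/-- The two arcs of the bar domain are disjoint. [folklore] -/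
theorem disjoint_arcs_barDomain (hc : 0 ≤ c) (hcW : c + 3 ≤ W) :
    Disjoint (barDomain W N c).toDobrushin.zdArcA (barDomain W N c).toDobrushin.zdArcB :=
  (barDomain W N c).disjoint_zdArcA_zdArcB regular_or_exposed_ofBox (exists_exposed_A_barDomain hc hcW)
    exists_exposed_B_barDomain

/-- **The two `A`–`B` edges of the bar domain**: the ring edges at the two ends of the bar. [folklore] -/
theorem zdABEdges_barDomain (hc : 0 ≤ c) (hcW : c + 3 ≤ W) :
    (barDomain W N c).toDobrushin.zdABEdges =
      {s(![c, (N : ℤ) + 1], ![c - 1, (N : ℤ) + 1]), s(![c + 3, (N : ℤ) + 1], ![c + 4, (N : ℤ) + 1])} := by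
  ext e
  induction e using Sym2.ind with
  | h x y =>
  rw [(barDomain W N c).mem_zdABEdges_iff regular_or_exposed_ofBox (exists_exposed_A_barDomain hc hcW)
    exists_exposed_B_barDomain]
  simp only [mem_insert_iff, mem_singleton_iff]
  constructor
  · rintro ⟨hadj, h⟩
    have key : ∀ x y : Site 2, (zdGraph 2).Adj x y → x ∈ (barDomain W N c).A → y ∈ (barDomain W N c).S →
        y ∉ (barDomain W N c).A → (barDomain W N c).Exposed y →
        (x = ![c, (N : ℤ) + 1] ∧ y = ![c - 1, (N : ℤ) + 1]) ∨ (x = ![c + 3, (N : ℤ) + 1] ∧ y = ![c + 4, (N : ℤ) + 1]) := by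
      intro x y hadj hxA hyS hyA hye
      rw [exposed_barDomain_iff hyS] at hye
      rw [mem_barDomain_S] at hyS
      rw [mem_barDomain_A] at hyA
      obtain ⟨⟨hx0, hx0', hx1, hx1'⟩, hx1'', hxc, hxc'⟩ := mem_barDomain_A.1 hxA
      obtain ⟨i, hi | hi⟩ := (zdGraph_adj_iff x y).1 hadj
      · have h0 := congrFun hi 0; have h1 := congrFun hi 1
        fin_cases i
        · simp at h0 h1
          have : y 0 = c + 4 := by
            by_contra hne; exact hyA ⟨hyS, by omega, by omega, by omega⟩
          right; constructor <;> (funext j; fin_cases j <;> simp <;> omega)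
        · simp at h0 h1; omega
      · have h0 := congrFun hi 0; have h1 := congrFun hi 1
        fin_cases i
        · simp at h0 h1
          have : y 0 = c - 1 := by
            by_contra hne; exact hyA ⟨hyS, by omega, by omega, by omega⟩
          left; constructor <;> (funext j; fin_cases j <;> simp <;> omega)
        · simp at h0 h1
          -- `y` is the site of `R` below the bar: not exposed
          exfalso
          rcases hye with h | h | h | h <;> omega
    rcases h with ⟨hxA, -, hyS, hyA, hye⟩ | ⟨hyA, -, hxS, hxA, hxe⟩
    · rcases key x y hadj hxA hyS hyA hye with ⟨rfl, rfl⟩ | ⟨rfl, rfl⟩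
      · exact Or.inl rfl
      · exact Or.inr rfl
    · rcases key y x hadj.symm hyA hxS hxA hxe with ⟨rfl, rfl⟩ | ⟨rfl, rfl⟩
      · exact Or.inl Sym2.eq_swap
      · exact Or.inr Sym2.eq_swap
  · have hA0 : (![c, (N : ℤ) + 1] : Site 2) ∈ (barDomain W N c).A := by rw [mem_barDomain_A]; simp; omega
    have hA3 : (![c + 3, (N : ℤ) + 1] : Site 2) ∈ (barDomain W N c).A := by rw [mem_barDomain_A]; simp; omega
    have hB0 : (![c - 1, (N : ℤ) + 1] : Site 2) ∈ (barDomain W N c).S ∧ (![c - 1, (N : ℤ) + 1] : Site 2) ∉ (barDomain W N c).A ∧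
        (barDomain W N c).Exposed ![c - 1, (N : ℤ) + 1] := by
      refine ⟨by rw [mem_barDomain_S]; simp; omega, by rw [mem_barDomain_A]; simp, ?_⟩
      rw [exposed_barDomain_iff (by rw [mem_barDomain_S]; simp; omega)]; simp
    have hB4 : (![c + 4, (N : ℤ) + 1] : Site 2) ∈ (barDomain W N c).S ∧ (![c + 4, (N : ℤ) + 1] : Site 2) ∉ (barDomain W N c).A ∧
        (barDomain W N c).Exposed ![c + 4, (N : ℤ) + 1] := by
      refine ⟨by rw [mem_barDomain_S]; simp; omega, by rw [mem_barDomain_A]; simp, ?_⟩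
      rw [exposed_barDomain_iff (by rw [mem_barDomain_S]; simp; omega)]; simp
    have hadj0 : (zdGraph 2).Adj (![c, (N : ℤ) + 1] : Site 2) ![c - 1, (N : ℤ) + 1] :=
      (zdGraph_adj_iff _ _).2 ⟨0, Or.inr (by funext j; fin_cases j <;> simp)⟩
    have hadj3 : (zdGraph 2).Adj (![c + 3, (N : ℤ) + 1] : Site 2) ![c + 4, (N : ℤ) + 1] :=
      (zdGraph_adj_iff _ _).2 ⟨0, Or.inl (by funext j; fin_cases j <;> simp; ring)⟩
    rintro (h | h) <;> rw [Sym2.eq_iff] at h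
    · rcases h with ⟨rfl, rfl⟩ | ⟨rfl, rfl⟩
      · exact ⟨hadj0, Or.inl ⟨hA0, exposed_of_mem_barDomain_A hA0, hB0⟩⟩
      · exact ⟨hadj0.symm, Or.inr ⟨hA0, exposed_of_mem_barDomain_A hA0, hB0⟩⟩
    · rcases h with ⟨rfl, rfl⟩ | ⟨rfl, rfl⟩
      · exact ⟨hadj3, Or.inl ⟨hA3, exposed_of_mem_barDomain_A hA3, hB4⟩⟩
      · exact ⟨hadj3.symm, Or.inr ⟨hA3, exposed_of_mem_barDomain_A hA3, hB4⟩⟩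

/-- Inner faces of the bar domain: all faces of the big box. [folklore] -/
theorem isInnerFace_barDomain_iff {f : Site 2} :
    (barDomain W N c).toDobrushin.IsInnerFace f ↔ -1 ≤ f 0 ∧ f 0 ≤ (W : ℤ) ∧ -1 ≤ f 1 ∧ f 1 ≤ (N : ℤ) := by
  rw [barDomain, isInnerFace_ofBox_iff]
  simp [Fin.forall_fin_two]
  constructor
  · rintro ⟨⟨h1, h2⟩, h3, h4⟩; omega
  · rintro ⟨h1, h2, h3, h4⟩; exact ⟨⟨h1, by omega⟩, h3, by omega⟩

/-- **Each `A`–`B` edge of the bar domain is a side of exactly one inner face** (the face between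
the ring and the top side of `R` below it). [folklore] -/
theorem zdABEdges_inner_barDomain (hc : 0 ≤ c) (hcW : c + 3 ≤ W) :
    ∀ e ∈ (barDomain W N c).toDobrushin.zdABEdges, ∃! f, (barDomain W N c).toDobrushin.IsInnerFace f ∧ ∀ x ∈ e, IsCorner x f := by
  rw [zdABEdges_barDomain hc hcW]
  have hv0 : (![c, (N : ℤ) + 1] : Site 2) = ![c - 1, (N : ℤ) + 1] + Pi.single 0 1 := by funext j; fin_cases j <;> simp
  have hv3 : (![c + 4, (N : ℤ) + 1] : Site 2) = ![c + 3, (N : ℤ) + 1] + Pi.single 0 1 := by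
    funext j; fin_cases j <;> simp; ring
  rintro e (rfl | rfl)
  · refine ⟨![c - 1, (N : ℤ) + 1] - Pi.single 1 1, ⟨isInnerFace_barDomain_iff.2 (by simp; omega), ?_⟩, ?_⟩
    · intro x hx
      rcases Sym2.mem_iff.1 hx with rfl | rfl
      · rw [hv0]; exact (isCorner_and_isCorner_add_e0_iff.2 (Or.inr rfl)).2
      · exact (isCorner_and_isCorner_add_e0_iff (x := ![c - 1, (N : ℤ) + 1]).2 (Or.inr rfl)).1
    · rintro f ⟨hf, hcf⟩
      have h1 : IsCorner (![c - 1, (N : ℤ) + 1] : Site 2) f := hcf _ (Sym2.mem_mk_right _ _)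
      have h2 : IsCorner ((![c - 1, (N : ℤ) + 1] : Site 2) + Pi.single 0 1) f := by
        rw [← hv0]; exact hcf _ (Sym2.mem_mk_left _ _)
      rcases isCorner_and_isCorner_add_e0_iff.1 ⟨h1, h2⟩ with rfl | rfl
      · exfalso
        have := (isInnerFace_barDomain_iff.1 hf).2.2.2
        simp at this
      · rfl
  · refine ⟨![c + 3, (N : ℤ) + 1] - Pi.single 1 1, ⟨isInnerFace_barDomain_iff.2 (by simp; omega), ?_⟩, ?_⟩
    · intro x hx
      rcases Sym2.mem_iff.1 hx with rfl | rfl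
      · exact (isCorner_and_isCorner_add_e0_iff (x := ![c + 3, (N : ℤ) + 1]).2 (Or.inr rfl)).1
      · rw [hv3]; exact (isCorner_and_isCorner_add_e0_iff.2 (Or.inr rfl)).2
    · rintro f ⟨hf, hcf⟩
      have h1 : IsCorner (![c + 3, (N : ℤ) + 1] : Site 2) f := hcf _ (Sym2.mem_mk_left _ _)
      have h2 : IsCorner ((![c + 3, (N : ℤ) + 1] : Site 2) + Pi.single 0 1) f := by
        rw [← hv3]; exact hcf _ (Sym2.mem_mk_right _ _)
      rcases isCorner_and_isCorner_add_e0_iff.1 ⟨h1, h2⟩ with rfl | rfl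
      · exfalso
        have := (isInnerFace_barDomain_iff.1 hf).2.2.2
        simp at this
      · rfl

/-- **The bar domain is admissible Dobrushin data** (`0 ≤ c`, `c + 3 ≤ W`). [folklore] -/
theorem isZdAdmissible_barDomain (hc : 0 ≤ c) (hcW : c + 3 ≤ W) : (barDomain W N c).toDobrushin.IsZdAdmissible := by
  refine (barDomain W N c).isZdAdmissible_of (disjoint_arcs_barDomain hc hcW) ?_ ?_ ?_ (zdABEdges_inner_barDomain hc hcW)
  · rw [zdArcA_barDomain hc hcW]; exact ⟨_, (exists_exposed_A_barDomain hc hcW).choose_spec.1⟩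
  · obtain ⟨b, hbS, hbA, hbe⟩ := exists_exposed_B_barDomain (W := W) (N := N) (c := c)
    exact ⟨b, (barDomain W N c).mem_zdArcB_of_exposed hbS hbA hbe (exists_exposed_A_barDomain hc hcW)⟩
  · rw [zdABEdges_barDomain hc hcW]
    refine Set.ncard_pair fun h => ?_
    have := congrArg (fun e : Sym2 (Site 2) => (![c, (N : ℤ) + 1] : Site 2) ∈ e) h
    simp only [Sym2.mem_iff, eq_iff_iff, true_or, true_iff] at this
    rcases this with h' | h'
    · have := congrFun h' 0; simp at this
    · have := congrFun h' 0; simp at this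

/-- **The wired arc of the bar domain is connected** (four consecutive ring sites). [folklore] -/
theorem preconnected_zdArcA_barDomain (hc : 0 ≤ c) (hcW : c + 3 ≤ W) :
    ((discreteDomainGraph (barDomain W N c).toDobrushin.Ω (barDomain W N c).toDobrushin.δ).induce
      (barDomain W N c).toDobrushin.zdArcA).Preconnected := by
  refine (barDomain W N c).preconnected_induce_zdArcA (zdArcA_barDomain hc hcW) (barDomain W N c).A_subset
    fun x hx y hy => ?_
  have topath : ∀ x ∈ (barDomain W N c).A,
      Relation.ReflTransGen (SiteStep (barDomain W N c).A) x ![c, (N : ℤ) + 1] := by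
    intro x hx
    obtain ⟨⟨hx0, hx0', hx1, hx1'⟩, hx1'', hxc, hxc'⟩ := mem_barDomain_A.1 hx
    have hleft := reflTransGen_siteStep_line_neg (T := (barDomain W N c).A) x 0 (x 0 - c).toNat fun k hk => by
      rw [mem_barDomain_A]
      have := Int.toNat_of_nonneg (show (0 : ℤ) ≤ x 0 - c by omega)
      simp [hx1'']; omega
    have hend : x - (((x 0 - c).toNat : ℕ) : ℤ) • (Pi.single 0 1 : Site 2) = ![c, (N : ℤ) + 1] := by
      have := Int.toNat_of_nonneg (show (0 : ℤ) ≤ x 0 - c by omega)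
      funext j; fin_cases j
      · simp; omega
      · simp [hx1'']
    rwa [hend] at hleft
  exact (topath x hx).trans (reflTransGen_siteStep_reverse (topath y hy))

/-- The inner faces of the bar domain form a hole-free set. [folklore] -/
theorem holeFree_barDomain : HoleFree {f | (barDomain W N c).toDobrushin.IsInnerFace f} :=
  holeFree_isInnerFace_ofBox

/-- **The rectangle `R = [0, W] × [0, N]` consists exactly of the regular sites of the bar domain**
(the sites off the discrete boundary, at which the Laplacian inequalities of the observable are
available). [folklore] -/
theorem regular_barDomain_iff {x : Site 2} :
    (barDomain W N c).Regular x ↔ 0 ≤ x 0 ∧ x 0 ≤ (W : ℤ) ∧ 0 ≤ x 1 ∧ x 1 ≤ (N : ℤ) := by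
  rw [barDomain, regular_ofBox_iff]
  simp [Fin.forall_fin_two]
  omega

/-- The discrete boundary of the bar domain is the ring. [folklore] -/
theorem zdBoundary_barDomain :
    (barDomain W N c).toDobrushin.zdBoundary = {x | x ∈ (barDomain W N c).S ∧
      (x 0 = -1 ∨ x 0 = (W : ℤ) + 1 ∨ x 1 = -1 ∨ x 1 = (N : ℤ) + 1)} := by
  rw [(barDomain W N c).zdBoundary_eq regular_or_exposed_ofBox]
  ext x
  simp only [mem_setOf_eq]
  constructor
  · rintro ⟨hxS, he⟩; exact ⟨hxS, (exposed_barDomain_iff hxS).1 he⟩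
  · rintro ⟨hxS, he⟩; exact ⟨hxS, (exposed_barDomain_iff hxS).2 he⟩

end LatticeDobrushin

end Literature.Probability.LatticeModels
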